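import Literature.Combinatorics.Sahi2008.Percolation
import HarnessLib

/-!
# Definitions for the "cdd" theorem (Kahn–Sahi `E₃ ≥ 0` with one cylinder complement / OR event): the antithetic tower

Definitions file (prover prim-ineq-prove-3 gen 13; objects of the proof in memo
`run/shared/lean/prim/prim-ineq-prove-3/FINDING-G13-CDD-THEOREM.md`; consumed by `…SahiCddTower`, `…SahiCddBase`, `…SahiCdd`).
Setting: `ι` finite, `p : ι → [0,1]`, the product weight `bernoulliWeight p` on `Set ι` and its expectation `ex`
(`Literature.Combinatorics.Sahi2008`), `F : Finset ι`, the OR event `U_F = {ω | ω ∩ F ≠ ∅}` (`orEvent F`; its complement is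
the "all of `F` closed" cylinder, and under `ω ↦ ωᶜ` it is the complement of the cylinder `{F ⊆ ω}`).

* `cddT p F f g` — Sahi's `E₃(1_U, f, g)` as a bilinear form in the real functions `f, g`
  (`2E[1_U f g] − E[1_U f]E[g] − E[1_U g]E[f] − E[fg]E[1_U] + E[1_U]E[f]E[g]`; on indicators it is `sahiE3 (prodBernoulli p) U A B`).
* `cddD p F h := E[(2·1_U − E 1_U)·h]` — the "decoupling defect" linear functional.
* `sec K x f := ω ↦ f((ω ∖ K) ∪ x)` — freeze the coordinates of `K` to the pattern `x ⊆ K`.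
* `cddP p F K f g := Σ_{x ⊆ K} [ cddT(f^x, g^{K∖x}) + cddD(f^x·(g^x − g^{K∖x})) ]` — the ANTITHETIC TOWER functional (`E₃` with the
  product terms evaluated under the antithetic coupling `x ↔ K ∖ x` of the coordinates in `K`); `cddP p F ∅ f g = cddT p F f g`.
* `cddMain p F K f g` — the manifestly nonnegative main part of the base-case certificate:
  `Σ_{x ⊆ K} { Cov(f^x,g^x) + z·Cov(f^x,g^{K∖x}) + z·[ g^x(∅)(E f^x − f^x(∅)) + f^x(∅)(E g^x − g^x(∅)) ] }`, `z = Π_{i∈F}(1 − p_i)`.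
-/

noncomputable section

namespace Summit.CriticalPhenomena.PercolationContinuityZ3.Theorems

namespace SahiCdd

open Literature.Combinatorics.Sahi2008
open Literature.Probability.Percolation.DecisionTree (ind)

variable {ι : Type*} [Fintype ι] [DecidableEq ι]

/-- The OR event `U_F = {ω | some coordinate of F is present}` (complement of the closed cylinder on `F`).
[cite: Kahn2022, Conjecture 5 (arXiv p. 3)] -/
def orEvent (F : Finset ι) : Set (Set ι) := {ω | ∃ i ∈ F, i ∈ ω}

/-- `z = μ(U_Fᶜ) = Π_{i∈F}(1 − p_i)`, the probability that all coordinates of `F` are absent. [this work] -/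
def zF (p : ι → unitInterval) (F : Finset ι) : ℝ := ∏ i ∈ F, (1 - (p i : ℝ))

/-- Sahi's `E₃(1_U, f, g)` as a bilinear form in `f, g` under the product weight (`U = orEvent F`).
[cite: LiebSahi2021, eq. (2.1) (arXiv p. 5)] -/
def cddT (p : ι → unitInterval) (F : Finset ι) (f g : Set ι → ℝ) : ℝ :=
  2 * ex (bernoulliWeight p) (ind (orEvent F) * f * g)
    - ex (bernoulliWeight p) (ind (orEvent F) * f) * ex (bernoulliWeight p) g
    - ex (bernoulliWeight p) (ind (orEvent F) * g) * ex (bernoulliWeight p) f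
    - ex (bernoulliWeight p) (f * g) * ex (bernoulliWeight p) (ind (orEvent F))
    + ex (bernoulliWeight p) (ind (orEvent F)) * ex (bernoulliWeight p) f * ex (bernoulliWeight p) g

/-- The decoupling-defect functional `D(h) = E[(2·1_U − E[1_U])·h]`. [this work] -/
def cddD (p : ι → unitInterval) (F : Finset ι) (h : Set ι → ℝ) : ℝ :=
  ex (bernoulliWeight p) (fun ω => (2 * ind (orEvent F) ω - ex (bernoulliWeight p) (ind (orEvent F))) * h ω)

/-- Freeze the coordinates of `K` to the pattern `x`: `(sec K x f)(ω) = f((ω ∖ K) ∪ x)`. [this work] -/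
def sec (K x : Finset ι) (f : Set ι → ℝ) : Set ι → ℝ := fun ω => f (ω \ (K : Set ι) ∪ (x : Set ι))

/-- **The antithetic tower functional** `P_K(f,g) = Σ_{x ⊆ K} [T(f^x, g^{K∖x}) + D(f^x (g^x − g^{K∖x}))]`. [this work] -/
def cddP (p : ι → unitInterval) (F K : Finset ι) (f g : Set ι → ℝ) : ℝ :=
  ∑ x ∈ K.powerset,
    (cddT p F (sec K x f) (sec K (K \ x) g) + cddD p F (sec K x f * (sec K x g - sec K (K \ x) g)))

/-- **Main (manifestly nonnegative) part of the base certificate**: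
`Σ_{x ⊆ K} { Cov(f^x,g^x) + z·Cov(f^x,g^{K∖x}) + z·[g^x(∅)(E f^x − f^x(∅)) + f^x(∅)(E g^x − g^x(∅))] }`. [this work] -/
def cddMain (p : ι → unitInterval) (F K : Finset ι) (f g : Set ι → ℝ) : ℝ :=
  ∑ x ∈ K.powerset,
    ((ex (bernoulliWeight p) (sec K x f * sec K x g)
        - ex (bernoulliWeight p) (sec K x f) * ex (bernoulliWeight p) (sec K x g))
      + zF p F * (ex (bernoulliWeight p) (sec K x f * sec K (K \ x) g)
        - ex (bernoulliWeight p) (sec K x f) * ex (bernoulliWeight p) (sec K (K \ x) g))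
      + zF p F * ((sec K x g) ∅ * (ex (bernoulliWeight p) (sec K x f) - (sec K x f) ∅)
        + (sec K x f) ∅ * (ex (bernoulliWeight p) (sec K x g) - (sec K x g) ∅)))

/-- Unfolding `cddP` at `K = ∅`: the tower functional without antithetic coordinates is `T` itself. [this work] -/
theorem cddP_empty (p : ι → unitInterval) (F : Finset ι) (f g : Set ι → ℝ) :
    cddP p F ∅ f g = cddT p F f g := by
  unfold cddP
  rw [Finset.powerset_empty, Finset.sum_singleton, Finset.sdiff_empty]
  have hsec : ∀ h : Set ι → ℝ, sec (∅ : Finset ι) ∅ h = h := fun h => by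
    funext ω; simp [sec]
  rw [hsec, hsec, sub_self, mul_zero]
  have hD : cddD p F (0 : Set ι → ℝ) = 0 := by
    unfold cddD ex; simp
  rw [hD, add_zero]

end SahiCdd

end Summit.CriticalPhenomena.PercolationContinuityZ3.Theorems
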